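import Summits.CriticalPhenomena.PercolationContinuityZ3.Theorems.PercNearOneGluingNoHeavyLowerTailThreePartitionCubeCheckPacked

/-!
# Twisted three-partition positivity (★★) = (M⁺-3) on SIX letters: soundness of the checker — **the masks of a coloured node**

Support file (cell `prim-sahi`, seat `prim-sahi-typer` gen 34/35; `--supports stmt-CriticalPhenomena-4575`).  Bookkeeping definitions only
(no `sorry`, standard axioms): for a node `pts` of the enumeration of `ThreePartition.Cube.chunkCheck` and a colouring word `mm`, the two
up-set masks `cU`, `cV` (complements of the class down-sets), the free-point mask `freeOf`, its down-set `dFOf`, the mask `upNOf` of the codes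
above some point, the chain bound `cbOf`, and the filters of `colourStep` as one Boolean `passes` (`colourStep_some`).  Their meaning is the
subject of `…CubeDict` / `…CubeFilters`; their sizes are bounded in `…CubeDict`. [this work]
-/

namespace Summit.CriticalPhenomena.PercolationContinuityZ3.Theorems.ThreePartition.Cube

open SahiGridPattern.Pair43 (countBelow)

/-! ### The masks of a colouring -/

/-- The first up-set mask of the colouring `mm` of the node `pts` (complement of the down-set of the first class). [this work] -/
def cU (m : ℕ) (pts : Array ℕ) (mm : ℕ) : ℕ := (mkTabs m).full ^^^ (classDown (mkTabs m) pts mm).1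

/-- The second up-set mask of the colouring `mm` of the node `pts`. [this work] -/
def cV (m : ℕ) (pts : Array ℕ) (mm : ℕ) : ℕ := (mkTabs m).full ^^^ (classDown (mkTabs m) pts mm).2

/-- The mask of the free points of the node (codes incomparable with every point). [this work] -/
def freeOf (m : ℕ) (pts : Array ℕ) : ℕ := (mkTabs m).full ^^^ ((mkTabs m).full &&& orTab (mkTabs m).cmpT pts)

/-- The down-set mask of the free points. [this work] -/
def dFOf (m : ℕ) (pts : Array ℕ) : ℕ := orBits (mkTabs m) (mkTabs m).subT (freeOf m pts)

/-- The mask of the codes above some point of the node. [this work] -/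
def upNOf (m : ℕ) (pts : Array ℕ) : ℕ := orTab (mkTabs m).supT pts

/-- The chain bound of the free points. [this work] -/
def cbOf (m : ℕ) (pts : Array ℕ) : ℕ := chainBound (mkTabs m) (freeOf m pts)

/-- The filters of `colourStep`, as one Boolean. [this work] -/
def passes (T : Tabs) (pts : Array ℕ) (K : Array ℕ) (cb upN : ℕ) (mm : ℕ) : Bool :=
  let n := pts.size
  let k1 := countBelow n fun j => inFirst mm j
  let k2 := n - k1
  if decide (cb < k1) || decide (cb < k2) then false
  else
    let dd := classDown T pts mm
    let U := T.full ^^^ dd.1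
    let V := T.full ^^^ dd.2
    if !((((minMask T U &&& V) ||| (minMask T V &&& U)) &&& upN) == 0) then false
    else if !(tieOk T pts K mm) then false
    else true

/-- `colourStep` on `some b`, through `passes`. [this work] -/
theorem colourStep_some (T : Tabs) (pts K : Array ℕ) (cb upN dF mm : ℕ) (b : Batch) :
    colourStep T pts K cb upN dF mm (some b) =
      if passes T pts K cb upN mm then pushPair T b (T.full ^^^ (classDown T pts mm).1) (T.full ^^^ (classDown T pts mm).2) dF else some b := by
  unfold colourStep passes
  simp only []
  split_ifs <;> first | rfl | simp_all

end Summit.CriticalPhenomena.PercolationContinuityZ3.Theorems.ThreePartition.Cube
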